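import Summits.CriticalPhenomena.PercolationContinuityZ3.Theorems.PercNearOneGluingNoHeavyLowerTailThreePointProductFormCornersAll
import Summits.CriticalPhenomena.PercolationContinuityZ3.Theorems.PercNearOneGluingNoHeavyLowerTailThreePointProductFormABPlus

/-!
# THEOREM C for the 12-state NORMAL-FORM automaton of gen 64 (the AM-form series at the corner letters `P+Q±R`)
# (Sahi programme, prover prim-sahi-p2 gen 65)

Support file (`--supports stmt-CriticalPhenomena-4575`).  Standard axioms, no sorries.  This file closes the gap left open in
`…ThreePointProductFormCorners`: it proves IN LEAN the trace identity linking the 3-dimensional trace form `tval` to the 12-state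
normal-form automaton `stepA/stepB, alphaA/alphaB, omegaA/omegaB` of `…ThreePointProductFormABPlus` (gen 64, THEOREM AB+), evaluated at the
two CORNER letters `M± = P + Q ± R` (`cstepA/cstepB`: the componentwise sum `stepA p + stepA q ± stepA r`), via the explicit sparse intertwiner
`Ψ` of the memo (§0(2c); `gen65/lab65/psi_intertwiner.py`): `evalCA w = ΨA(N_w e1, N_w e2, N_w e3, |w|)`, `evalCB w = ΨB(…)` (`evalC_eq_psi`), hence
`cornerCoeff w := alphaA (evalCA w) + alphaB (evalCB w) = tval w` (`cornerCoeff_eq_tval`) and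

* `cornerCoeff_nonneg : ∀ w : List Bool, 0 ≤ cornerCoeff w` — THEOREM C for the normal form: the AM-form series `A = #P1 + #P2 − 2·#bad`
  (whose `(s²,d²,sd)`-coefficients are `coeff` of gen 64) evaluated at `s_t = 1, d_t = ±1` (every vertex of the cycle carries a pendant edge to `s`
  or to `c`, in any pattern, any length) is nonnegative: `2·#bad ≤ #P1 + #P2` at every corner of the physical box.
[this work] (gen 65).
-/

namespace Summit.CriticalPhenomena.PercolationContinuityZ3.Theorems.ProductFormCorners

open Summit.CriticalPhenomena.PercolationContinuityZ3.Theorems.ProductFormABPlus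

/-- The corner letter on the `a`-part of the normal form: `M± = P + Q ± R`, i.e. `stepA p + stepA q ± stepA r` componentwise. [this work] -/
def cstepA : Bool → StA → StA
  | true, s =>
    let sp := stepA .p s
    let sq := stepA .q s
    let sr := stepA .r s
    ⟨sp.t + sq.t + sr.t, sp.l0 + sq.l0 + sr.l0, sp.e1a + sq.e1a + sr.e1a, sp.e2a + sq.e2a + sr.e2a,
     sp.e1b + sq.e1b + sr.e1b, sp.e2b + sq.e2b + sr.e2b, sp.o1 + sq.o1 + sr.o1, sp.o2 + sq.o2 + sr.o2⟩
  | false, s =>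
    let sp := stepA .p s
    let sq := stepA .q s
    let sr := stepA .r s
    ⟨sp.t + sq.t - sr.t, sp.l0 + sq.l0 - sr.l0, sp.e1a + sq.e1a - sr.e1a, sp.e2a + sq.e2a - sr.e2a,
     sp.e1b + sq.e1b - sr.e1b, sp.e2b + sq.e2b - sr.e2b, sp.o1 + sq.o1 - sr.o1, sp.o2 + sq.o2 - sr.o2⟩

/-- The corner letter on the `b`-part of the normal form: `stepB p + stepB q ± stepB r` componentwise. [this work] -/
def cstepB : Bool → StB → StB
  | true, s =>
    let sp := stepB .p s
    let sq := stepB .q s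
    let sr := stepB .r s
    ⟨sp.E5 + sq.E5 + sr.E5, sp.E4 + sq.E4 + sr.E4, sp.f1 + sq.f1 + sr.f1, sp.f2 + sq.f2 + sr.f2⟩
  | false, s =>
    let sp := stepB .p s
    let sq := stepB .q s
    let sr := stepB .r s
    ⟨sp.E5 + sq.E5 - sr.E5, sp.E4 + sq.E4 - sr.E4, sp.f1 + sq.f1 - sr.f1, sp.f2 + sq.f2 - sr.f2⟩

/-- `a`-part state reached by a corner word (column action). [this work] -/
def evalCA : List Bool → StA
  | [] => omegaA
  | b :: w => cstepA b (evalCA w)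

/-- `b`-part state reached by a corner word. [this work] -/
def evalCB : List Bool → StB
  | [] => omegaB
  | b :: w => cstepB b (evalCB w)

/-- The corner value of the AM-form series: `α · M_{w₁} ⋯ M_{w_k} · ω` on the 12-state normal form. [this work] -/
def cornerCoeff (w : List Bool) : ℚ := alphaA (evalCA w) + alphaB (evalCB w)

/-- The `a`-part of the intertwiner `Ψ`: the normal-form state as an explicit linear function of the three 3-dimensional orbits
`a = N_w e1`, `b = N_w e2`, `c = N_w e3` and the length `k`. [this work] -/
def psiA (a b : V3) (k : ℚ) : StA := ⟨(8/3 : ℚ), (-154/45 : ℚ) * a.y + (56/45 : ℚ) * b.y + (28/45 : ℚ) * k + (-56/45 : ℚ), (11/10 : ℚ) * a.x + (-2/5 : ℚ) * b.x + (-11/10 : ℚ), (11/10 : ℚ) * a.y + (-2/5 : ℚ) * b.y + (2/5 : ℚ), (-74/75 : ℚ) * a.x + (8/25 : ℚ) * b.x + (74/75 : ℚ), (-74/75 : ℚ) * a.y + (8/25 : ℚ) * b.y + (-8/25 : ℚ), (11/10 : ℚ) * a.z + (-2/5 : ℚ) * b.z, (-74/75 : ℚ) * a.z + (8/25 : ℚ)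 * b.z⟩

/-- The `b`-part of the intertwiner `Ψ`. [this work] -/
def psiB (c : V3) : StB := ⟨(-1/10 : ℚ) * c.z, (1 : ℚ), (-1/10 : ℚ) * c.x, (-1/10 : ℚ) * c.y⟩

/-- Intertwining, `a`-part: `M± ΨA(a,b,c,k) = ΨA(M± a, M± b, M± c, k+1)`. [this work] -/
theorem cstepA_psiA (bb : Bool) (a b : V3) (k : ℚ) :
    cstepA bb (psiA a b k) = psiA (step bb a) (step bb b) (k + 1) := by
  cases bb <;> simp only [cstepA, psiA, stepA, step, mP, mM, StA.mk.injEq] <;>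
    refine ⟨?_, ?_, ?_, ?_, ?_, ?_, ?_, ?_⟩ <;> ring

/-- Intertwining, `b`-part. [this work] -/
theorem cstepB_psiB (bb : Bool) (c : V3) :
    cstepB bb (psiB c) = psiB (step bb c) := by
  cases bb <;> simp only [cstepB, psiB, stepB, step, mP, mM, StB.mk.injEq] <;>
    refine ⟨?_, ?_, ?_, ?_⟩ <;> ring

/-- The normal-form orbit IS `Ψ` of the three 3-dimensional orbits (induction on the word). [this work] -/
theorem evalC_eq_psi (w : List Bool) :
    evalCA w = psiA (iter w e1) (iter w e2) (w.length : ℚ) ∧ evalCB w = psiB (iter w e3) := by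
  induction w with
  | nil =>
    refine ⟨?_, ?_⟩
    · simp only [evalCA, omegaA, psiA, iter, e1, e2, List.length_nil, StA.mk.injEq]; norm_num
    · simp only [evalCB, omegaB, psiB, iter, e3, StB.mk.injEq]; norm_num
  | cons bb w ih =>
    obtain ⟨ihA, ihB⟩ := ih
    refine ⟨?_, ?_⟩
    · simp only [evalCA, ihA, cstepA_psiA, iter, List.length_cons, Nat.cast_add, Nat.cast_one]
    · simp only [evalCB, ihB, cstepB_psiB, iter]

/-- THE TRACE IDENTITY: the corner value of the 12-state normal form equals the 3-dimensional trace form `tval`. [this work] -/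
theorem cornerCoeff_eq_tval (w : List Bool) : cornerCoeff w = tval w := by
  obtain ⟨hA, hB⟩ := evalC_eq_psi w
  unfold cornerCoeff tval
  rw [hA, hB]
  simp only [alphaA, alphaB, psiA, psiB, dot, om1, om2, om3]
  ring

/-- ★ THEOREM C for the normal form.  For every sign pattern `w` (every cycle length): the AM-form series of the one-child boundary-star
cycle evaluated at the corner letters (`s_t = 1`, `d_t = ±1`: a pendant `s`- or `c`-edge at each cycle vertex) is nonnegative,
`2·#bad ≤ #P1 + #P2`. [this work] -/
theorem cornerCoeff_nonneg (w : List Bool) : 0 ≤ cornerCoeff w := by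
  rw [cornerCoeff_eq_tval]; exact corner_nonneg w

end Summit.CriticalPhenomena.PercolationContinuityZ3.Theorems.ProductFormCorners
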